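import Literature.AlgebraicGeometry.HodgeTheory.WeilTypeFivefoldTimesCMCurveBlockData
import Literature.AlgebraicGeometry.Motives.AbelianVarietyEndAlgebraProdOfHomEqZero
import Literature.AlgebraicGeometry.VanGeemen1994.WeilTypeEndFieldOfRankTwo
import Literature.AlgebraicGeometry.HodgeTheory.RankOneCentreTimesCMCurveProductSpan
import Literature.AlgebraicGeometry.HodgeTheory.HodgeClassesProductSpanCMSquare
import HarnessLib

/-!
# The blocked socket's data at `A = Y₅ × E_k`, in the socket's own shapes (TABLE X row 17; cell `pub-hodgeav-hg6`,
# eng-3 g4, brick E17b)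

The blocked Lie → group socket `IsWeilType.mem_hodgeGroupOne_of_mem_unitaryCentralizerGroup_blocked_of_hodgeLieC`
(`WeilTypeBlockedHodgeGroupOfLie`) displays, for a blocking endomorphism `φ_E` and colours `μ : ι → ℂ`, the data `hEcard`
(`finrank_ℚ End⁰(A) = 2|ι|`), `hinj`, `hdist`, `hWne` (every block `W_{μ k}`, `W_{μ̄ k}` non-zero, indexed by `ι × Fin 2` with
the colour `if t = 0 then μ k else conj (μ k)`), `htop` (the blocks span `H¹(A) ⊗ ℂ`), `hKE` ∕ `hKE'` (`W_{μ k} ⊆ W_{i√d}(Φ)`,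
`W_{μ̄ k} ⊆ W_{−i√d}(Φ)`). This file supplies ALL of them, in exactly those shapes, at `A = Y × E`, `ι = Fin 2`,
`μ k = (k+1)·i√d`, `φ_E := diag(φ_Y, 2χ)`, from the member-defining data of row 17 (`φ_Y ≫ φ_Y = −d`, `χ ≫ χ = −d`, `d > 0`,
`dim Y = 5`, `dim E = 1`, `finrank_ℚ End⁰(Y) = 2`) and NOTHING ELSE: `finrank_ℚ End⁰(E) = 2` for the CM curve is the tree's
`finrank_endAlgebra_eq_two_of_cmCurve hE1 (isOfCMType_of_cmCurve hE1 hd hχ)` (lead g4 ruling 11:04:51Z), and `hEcard` follows through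
`finrank_endAlgebra_prod_of_isSimple_of_dim_ne` (`Hom(Y, E) = 0` for simple factors of different dimension). `hinj` ∕ `hdist` are
`CMCurveFivefold.colour_injective` ∕ `colour_ne_conj` of the prequel. KERNEL ONLY: no definition, no `sorry`, no named fact;
HC ∕ HC_AV are not mentioned.

## References
* [MoonenZarhin1999LowDim] B. Moonen, Yu. Zarhin, Math. Ann. 315 (1999), §2 (2.4) and §5 (5.2)–(5.3).
* [Milne1999LefschetzClasses] J. S. Milne, Duke Math. J. 96 (1999), §1 p. 642 (endomorphisms of products).
* [VoisinHodgeI2002] C. Voisin, Hodge Theory and Complex Algebraic Geometry I (2002), §11.3.3 Thm. 11.38.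
-/

noncomputable section

open scoped TensorProduct
open CategoryTheory Module

namespace Literature.AlgebraicGeometry.HodgeTheory

open Literature.AlgebraicTopology.SingularHomology
open Literature.AlgebraicGeometry.Motives (AbelianVariety bettiCohomology)
open Literature.AlgebraicGeometry.Motives.AbelianVariety (fst snd)
open Literature.AlgebraicGeometry.Milne1999.CMTypeProducts (blockDiag)

variable {Y E : AbelianVariety ℂ} {d : ℕ} {φY : Y ⟶ Y} {χ : E ⟶ E}

/-- The two elements of `Fin 2`. [folklore] -/
private theorem fin2_eq (r : Fin 2) : r = 0 ∨ r = 1 := by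
  rcases r with ⟨_ | _ | n, hr⟩
  · exact Or.inl rfl
  · exact Or.inr rfl
  · omega

/-- `((0 : Fin 2) + 1) c = c`. [folklore] -/
private theorem colour_zero (c : ℂ) : ((((0 : Fin 2) : ℕ) : ℂ) + 1) * c = c := by
  rw [Fin.val_zero, Nat.cast_zero, zero_add, one_mul]

/-- `((1 : Fin 2) + 1) c = 2c`. [folklore] -/
private theorem colour_one (c : ℂ) : ((((1 : Fin 2) : ℕ) : ℂ) + 1) * c = (2 : ℂ) * c := by
  rw [Fin.val_one, Nat.cast_one, one_add_one_eq_two]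

/-- `(i√d)(i√d) = −d`. [folklore] -/
private theorem root_mul_self (d : ℕ) :
    (Complex.I * (Real.sqrt d : ℂ)) * (Complex.I * (Real.sqrt d : ℂ)) = -(d : ℂ) := by
  rw [mul_mul_mul_comm, Complex.I_mul_I, ← Complex.ofReal_mul, Real.mul_self_sqrt (Nat.cast_nonneg d),
    Complex.ofReal_natCast, neg_one_mul]

/-- **hEcard** at `Y₅ × E_k`: `finrank_ℚ End⁰(Y × E) = 2 · |Fin 2|` (`End⁰(Y) = k`; `End⁰(E) = k` for the CM curve `E`,
`χ ≫ χ = −d`; `Hom(Y, E) = 0`).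
[cite: MoonenZarhin1999LowDim, §2 (2.4) and §5 (5.3)] [cite: Milne1999LefschetzClasses, §1 p. 642] -/
theorem CMCurveFivefold.finrank_endAlgebra_prod_eq (hY5 : Y.dim = 5) (hd : 0 < d) (hφY : φY ≫ φY = -(d • 𝟙 Y))
    (hE2 : Module.finrank ℚ Y.endAlgebra = 2) (hE1 : E.dim = 1) (hχ : χ ≫ χ = -(d • 𝟙 E)) :
    Module.finrank ℚ (Y.prod E).endAlgebra = 2 * Fintype.card (Fin 2) := by
  have hYs : Y.IsSimple := VanGeemen1994.isSimple_of_finrank_endAlgebra_eq_two (by omega) hd hφY hE2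
  have hEs : E.IsSimple := AbelianVariety.isSimple_of_dim_le_one hE1.le
  have hEE : Module.finrank ℚ E.endAlgebra = 2 := finrank_endAlgebra_eq_two_of_cmCurve hE1 (isOfCMType_of_cmCurve hE1 hd hχ)
  rw [AbelianVariety.finrank_endAlgebra_prod_of_isSimple_of_dim_ne hYs hEs (by omega), hE2, hEE, Fintype.card_fin]

/-- **hWne** at `Y₅ × E_k`: all four blocks `W_{± i√d}(φ_E)`, `W_{± 2i√d}(φ_E)` of `φ_E = diag(φ_Y, 2χ)` are non-zero, in the
socket's `ι × Fin 2` indexing. [cite: MoonenZarhin1999LowDim, §5 (5.2)] -/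
theorem CMCurveFivefold.eigenspace_block_ne_bot (hd : 0 < d) (h0Y : 0 < Y.dim) (h0E : 0 < E.dim)
    (hφY : φY ≫ φY = -(d • 𝟙 Y)) (hχ : χ ≫ χ = -(d • 𝟙 E)) :
    ∀ kt : Fin 2 × Fin 2, Module.End.eigenspace
        (((bettiCohomology.map (blockDiag Y E φY (2 • χ)).hom.hom.hom 1).hom).baseChange ℂ)
        (if kt.2 = 0 then (((kt.1 : ℕ) : ℂ) + 1) * (Complex.I * (Real.sqrt d : ℂ))
          else starRingEnd ℂ ((((kt.1 : ℕ) : ℂ) + 1) * (Complex.I * (Real.sqrt d : ℂ)))) ≠ ⊥ := by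
  rintro ⟨k, t⟩
  rcases fin2_eq t with rfl | rfl
  · rw [if_pos rfl]
    rcases fin2_eq k with rfl | rfl
    · rw [colour_zero]; exact CMCurveFivefold.eigenspace_colour₀_ne_bot hd h0Y hφY hχ (Or.inl rfl)
    · rw [colour_one]; exact CMCurveFivefold.eigenspace_colour₁_ne_bot hd h0E hφY hχ (Or.inl rfl)
  · rw [if_neg (show (1 : Fin 2) ≠ 0 from one_ne_zero), CMCurveFivefold.starRingEnd_colour]
    rcases fin2_eq k with rfl | rfl
    · rw [colour_zero]; exact CMCurveFivefold.eigenspace_colour₀_ne_bot hd h0Y hφY hχ (Or.inr rfl)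
    · rw [colour_one]; exact CMCurveFivefold.eigenspace_colour₁_ne_bot hd h0E hφY hχ (Or.inr rfl)

/-- **htop** at `Y₅ × E_k`: the four blocks span `H¹(Y × E) ⊗ ℂ`, in the socket's `⨆` over `Fin 2 × Fin 2`.
[cite: MoonenZarhin1999LowDim, §5 (5.2)] [cite: VoisinHodgeI2002, §11.3.3 Thm. 11.38] -/
theorem CMCurveFivefold.iSup_eigenspace_block_eq_top (hd : 0 < d) (hφY : φY ≫ φY = -(d • 𝟙 Y))
    (hχ : χ ≫ χ = -(d • 𝟙 E)) :
    (⨆ kt : Fin 2 × Fin 2, Module.End.eigenspace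
        (((bettiCohomology.map (blockDiag Y E φY (2 • χ)).hom.hom.hom 1).hom).baseChange ℂ)
        (if kt.2 = 0 then (((kt.1 : ℕ) : ℂ) + 1) * (Complex.I * (Real.sqrt d : ℂ))
          else starRingEnd ℂ ((((kt.1 : ℕ) : ℂ) + 1) * (Complex.I * (Real.sqrt d : ℂ))))) = ⊤ := by
  rw [eq_top_iff, ← CMCurveFivefold.sup_eigenspace_colour_eq_top hd hφY hχ]
  refine sup_le (sup_le ?_ ?_) (sup_le ?_ ?_)
  · refine le_iSup_of_le ((0 : Fin 2), (0 : Fin 2)) (le_of_eq ?_)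
    rw [if_pos rfl, colour_zero]
  · refine le_iSup_of_le ((0 : Fin 2), (1 : Fin 2)) (le_of_eq ?_)
    rw [if_neg (show (1 : Fin 2) ≠ 0 from one_ne_zero), CMCurveFivefold.starRingEnd_colour, colour_zero]
  · refine le_iSup_of_le ((1 : Fin 2), (0 : Fin 2)) (le_of_eq ?_)
    rw [if_pos rfl, colour_one]
  · refine le_iSup_of_le ((1 : Fin 2), (1 : Fin 2)) (le_of_eq ?_)
    rw [if_neg (show (1 : Fin 2) ≠ 0 from one_ne_zero), CMCurveFivefold.starRingEnd_colour, colour_one]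

/-- **hKE** at `Y₅ × E_k`: `W_{μ k}(φ_E) ⊆ W_{i√d}(Φ)` for the diagonal Weil operator `Φ = diag(φ_Y, χ)`.
[cite: MoonenZarhin1999LowDim, §5 (5.2)] -/
theorem CMCurveFivefold.eigenspace_block_le_weil (hd : 0 < d) (hφY : φY ≫ φY = -(d • 𝟙 Y)) (hχ : χ ≫ χ = -(d • 𝟙 E))
    {Φ : Y.prod E ⟶ Y.prod E} (hΦ₁ : Φ ≫ fst Y E = fst Y E ≫ φY) (hΦ₂ : Φ ≫ snd Y E = snd Y E ≫ χ) :
    ∀ k : Fin 2, Module.End.eigenspace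
        (((bettiCohomology.map (blockDiag Y E φY (2 • χ)).hom.hom.hom 1).hom).baseChange ℂ)
        ((((k : ℕ) : ℂ) + 1) * (Complex.I * (Real.sqrt d : ℂ))) ≤
      Module.End.eigenspace (((bettiCohomology.map Φ.hom.hom.hom 1).hom).baseChange ℂ)
        (Complex.I * (Real.sqrt d : ℂ)) := by
  intro k
  rcases fin2_eq k with rfl | rfl
  · rw [colour_zero]; exact CMCurveFivefold.eigenspace_colour₀_le hd hχ hΦ₁ hΦ₂ (root_mul_self d)
  · rw [colour_one]; exact CMCurveFivefold.eigenspace_colour₁_le hd hφY hΦ₁ hΦ₂ (root_mul_self d)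

/-- **hKE′** at `Y₅ × E_k`: `W_{μ̄ k}(φ_E) ⊆ W_{−i√d}(Φ)`. [cite: MoonenZarhin1999LowDim, §5 (5.2)]
[cite: Deligne1982HodgeCycles, §4 (p. 30)] -/
theorem CMCurveFivefold.eigenspace_block_conj_le_weil (hd : 0 < d) (hφY : φY ≫ φY = -(d • 𝟙 Y))
    (hχ : χ ≫ χ = -(d • 𝟙 E)) {Φ : Y.prod E ⟶ Y.prod E} (hΦ₁ : Φ ≫ fst Y E = fst Y E ≫ φY)
    (hΦ₂ : Φ ≫ snd Y E = snd Y E ≫ χ) :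
    ∀ k : Fin 2, Module.End.eigenspace
        (((bettiCohomology.map (blockDiag Y E φY (2 • χ)).hom.hom.hom 1).hom).baseChange ℂ)
        (starRingEnd ℂ ((((k : ℕ) : ℂ) + 1) * (Complex.I * (Real.sqrt d : ℂ)))) ≤
      Module.End.eigenspace (((bettiCohomology.map Φ.hom.hom.hom 1).hom).baseChange ℂ)
        (-(Complex.I * (Real.sqrt d : ℂ))) := by
  have hneg : -(Complex.I * (Real.sqrt d : ℂ)) * -(Complex.I * (Real.sqrt d : ℂ)) = -(d : ℂ) := by
    rw [neg_mul_neg]; exact root_mul_self d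
  intro k
  rw [CMCurveFivefold.starRingEnd_colour]
  rcases fin2_eq k with rfl | rfl
  · rw [colour_zero]; exact CMCurveFivefold.eigenspace_colour₀_le hd hχ hΦ₁ hΦ₂ hneg
  · rw [colour_one]; exact CMCurveFivefold.eigenspace_colour₁_le hd hφY hΦ₁ hΦ₂ hneg

end Literature.AlgebraicGeometry.HodgeTheory

end
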